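import Mathlib
import Summits.Ventures.HodgeRepro.Tier4.Target
import Summits.Ventures.HodgeRepro.Tier4.Line3.Defs
import Summits.Ventures.HodgeRepro.Tier4.Line3.LocaliserS

/-!
# Tier4/Line3/StableLattice — a `Γ`-stable lattice containing the support lattices (rung (I2) of L3.5)

Blind re-derivation cell `pub-hodge-repro`, Tier 4 «PROVE THE STEP» (README §9–§10), LINE L3, seat t4-L2-p1 (on L3.5
with t4-L2-p3).  Rung (I2) of the INVARIANT-MAJORANT route to the residual `OffMainMass` (t4-L2-p3 g2, S12951): every
finite family of lattices `L ⊂ E³` (finitely generated `𝒪`-submodules spanning `E³`) and every finite set of vectors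
lie in ONE lattice `d⁻¹ 𝒪³` (`denomLattice d`, `d ∈ 𝒪 ∖ 0` a common denominator, `IsLocalization.exist_integer_multiples_of_finset`),
and `d⁻¹ 𝒪³` is stable under `Γ ⊆ U(H)(𝒪)` (the entries of `γ ∈ Γ` are algebraic integers, `IsCongruenceSubgroup`).
Applied to the support clause of a localiser `ℓ : LocS` this gives ONE `Γ`-stable lattice `L′ ∋ xm` with every
support lattice `L ∈ S` inside it, so the support of `coefQ (loc N)` lies in `xm + (𝔭 𝔭̄)^N L′` — the lattice over
which the invariant class bound (I3) sums its Gaussians.  Mathlib-level.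
Nothing here asserts anything about the truth of (P); HC_CM is NOT proved by anyone in this repository.
-/

set_option autoImplicit false

noncomputable section

namespace Summit.Ventures.HodgeRepro.Tier4.Line3

open Summit.Ventures.HodgeRepro.Tier4
open Matrix NumberField

namespace T4Data

variable (X : T4Data)

/-- The lattice `d⁻¹ 𝒪³ ⊂ E³`, spanned over `𝒪` by the `d⁻¹ e_i`. -/
def denomLattice (d : 𝓞 X.E) : Submodule (𝓞 X.E) (Fin 3 → X.E) :=
  Submodule.span (𝓞 X.E) (Set.range fun i : Fin 3 => Pi.single i ((d : X.E)⁻¹))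

/-- `x ∈ d⁻¹ 𝒪³` iff every `d x_i` is an algebraic integer (`d ≠ 0`). -/
theorem mem_denomLattice_iff {d : 𝓞 X.E} (hd : d ≠ 0) (x : Fin 3 → X.E) :
    x ∈ X.denomLattice d ↔ ∀ i, IsIntegral ℤ ((d : X.E) * x i) := by
  have hd' : (d : X.E) ≠ 0 := by exact_mod_cast hd
  constructor
  · intro hx
    refine Submodule.span_induction ?_ ?_ ?_ ?_ hx
    · rintro _ ⟨i, rfl⟩ j
      by_cases h : j = i
      · subst h
        simp only [Pi.single_eq_same, mul_inv_cancel₀ hd']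
        exact isIntegral_one
      · simp only [Pi.single_eq_of_ne h, mul_zero]
        exact isIntegral_zero
    · intro i
      simp only [Pi.zero_apply, mul_zero]
      exact isIntegral_zero
    · intro y y' _ _ hy hy' i
      rw [Pi.add_apply, mul_add]
      exact (hy i).add (hy' i)
    · intro a y _ hy i
      rw [Pi.smul_apply, Algebra.smul_def, mul_left_comm]
      exact (RingOfIntegers.isIntegral_coe a).mul (hy i)
  · intro h
    have hx : x = ∑ i, (⟨(d : X.E) * x i, h i⟩ : 𝓞 X.E) • Pi.single i ((d : X.E)⁻¹) := by
      ext j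
      rw [Finset.sum_apply]
      simp only [Pi.smul_apply, Pi.single_apply, smul_ite, smul_zero, Finset.sum_ite_eq, Finset.mem_univ,
        if_true]
      rw [Algebra.smul_def]
      show x j = (d : X.E) * x j * (d : X.E)⁻¹
      field_simp
    rw [hx]
    exact Submodule.sum_mem _ fun i _ => Submodule.smul_mem _ _ (Submodule.subset_span ⟨i, rfl⟩)

/-- `d₁ ∣ d₂` gives `d₁⁻¹ 𝒪³ ⊆ d₂⁻¹ 𝒪³`. -/
theorem denomLattice_mono {d₁ d₂ : 𝓞 X.E} (h₁ : d₁ ≠ 0) (h₂ : d₂ ≠ 0) (hdvd : d₁ ∣ d₂) :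
    X.denomLattice d₁ ≤ X.denomLattice d₂ := by
  obtain ⟨e, rfl⟩ := hdvd
  intro x hx
  rw [mem_denomLattice_iff X h₁] at hx
  rw [mem_denomLattice_iff X h₂]
  intro i
  push_cast
  rw [mul_right_comm]
  exact (hx i).mul (RingOfIntegers.isIntegral_coe e)

/-- `d⁻¹ 𝒪³` is a lattice (finitely generated, spanning `E³`). -/
theorem isLattice_denomLattice {d : 𝓞 X.E} (hd : d ≠ 0) : X.IsLattice (X.denomLattice d) := by
  have hd' : (d : X.E) ≠ 0 := by exact_mod_cast hd
  refine ⟨Submodule.fg_span (Set.finite_range _), ?_⟩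
  rw [eq_top_iff]
  intro v _
  have hv : v = ∑ i, (v i * (d : X.E)) • Pi.single i ((d : X.E)⁻¹) := by
    ext j
    simp only [Finset.sum_apply, Pi.smul_apply, smul_eq_mul, Pi.single_apply, mul_ite, mul_zero,
      Finset.sum_ite_eq, Finset.mem_univ, if_true]
    field_simp
  rw [hv]
  exact Submodule.sum_mem _ fun i _ =>
    Submodule.smul_mem _ _ (Submodule.subset_span (Submodule.subset_span ⟨i, rfl⟩))

/-- `Γ` preserves `d⁻¹ 𝒪³`: the entries of `γ ∈ Γ ⊆ U(H)(𝒪)` are algebraic integers. -/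
theorem mulVec_mem_denomLattice {d : 𝓞 X.E} (hd : d ≠ 0) {γ : Matrix (Fin 3) (Fin 3) X.E} (hγ : γ ∈ X.Γ)
    {x : Fin 3 → X.E} (hx : x ∈ X.denomLattice d) : γ *ᵥ x ∈ X.denomLattice d := by
  have hint : IsIntegralMatrix γ := (X.hΓ.2.2.2.1 hγ).2.1
  rw [mem_denomLattice_iff X hd] at hx ⊢
  intro i
  simp only [Matrix.mulVec, dotProduct, Finset.mul_sum]
  refine IsIntegral.sum _ fun j _ => ?_
  rw [mul_left_comm]
  exact (hint i j).mul (hx j)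

/-- Finitely many vectors of `E³` have a common denominator: they lie in one `d⁻¹ 𝒪³`. -/
theorem exists_denom_of_finset (t : Finset (Fin 3 → X.E)) :
    ∃ d : 𝓞 X.E, d ≠ 0 ∧ ∀ v ∈ t, v ∈ X.denomLattice d := by
  classical
  obtain ⟨b, hb⟩ := IsLocalization.exist_integer_multiples_of_finset (nonZeroDivisors (𝓞 X.E))
    (t.biUnion fun v => Finset.univ.image fun i => v i)
  refine ⟨b, nonZeroDivisors.coe_ne_zero b, fun v hv => ?_⟩
  rw [mem_denomLattice_iff X (nonZeroDivisors.coe_ne_zero b)]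
  intro i
  obtain ⟨a, ha⟩ := hb (v i) (Finset.mem_biUnion.mpr ⟨v, hv, Finset.mem_image.mpr ⟨i, Finset.mem_univ _, rfl⟩⟩)
  rw [Algebra.smul_def] at ha
  rw [← ha]
  exact RingOfIntegers.isIntegral_coe a

/-- A lattice lies in some `d⁻¹ 𝒪³`. -/
theorem exists_le_denomLattice {L : Submodule (𝓞 X.E) (Fin 3 → X.E)} (hL : X.IsLattice L) :
    ∃ d : 𝓞 X.E, d ≠ 0 ∧ L ≤ X.denomLattice d := by
  obtain ⟨s, hs⟩ := hL.1
  obtain ⟨d, hd, hsd⟩ := X.exists_denom_of_finset s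
  refine ⟨d, hd, ?_⟩
  rw [← hs, Submodule.span_le]
  intro v hv
  exact hsd v hv

/-- **(I2) A `Γ`-STABLE LATTICE CONTAINING FINITELY MANY LATTICES AND VECTORS**: for finitely many lattices `L ∈ S`
and vectors `v ∈ T` there is `d ∈ 𝒪 ∖ 0` with `L ⊆ d⁻¹ 𝒪³`, `v ∈ d⁻¹ 𝒪³` and `Γ · d⁻¹ 𝒪³ ⊆ d⁻¹ 𝒪³`. -/
theorem exists_stable_lattice (S : Finset (Submodule (𝓞 X.E) (Fin 3 → X.E))) (hS : ∀ L ∈ S, X.IsLattice L)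
    (T : Finset (Fin 3 → X.E)) :
    ∃ d : 𝓞 X.E, d ≠ 0 ∧ X.IsLattice (X.denomLattice d) ∧ (∀ L ∈ S, L ≤ X.denomLattice d) ∧
      (∀ v ∈ T, v ∈ X.denomLattice d) ∧
      ∀ γ ∈ X.Γ, ∀ x ∈ X.denomLattice d, γ *ᵥ x ∈ X.denomLattice d := by
  choose! f hf using fun L (hL : L ∈ S) => X.exists_le_denomLattice (hS L hL)
  obtain ⟨d₀, hd₀, hT⟩ := X.exists_denom_of_finset T
  have hprod : (∏ L ∈ S, f L) ≠ 0 := Finset.prod_ne_zero_iff.mpr fun L hL => (hf L hL).1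
  have hd : d₀ * ∏ L ∈ S, f L ≠ 0 := mul_ne_zero hd₀ hprod
  refine ⟨d₀ * ∏ L ∈ S, f L, hd, X.isLattice_denomLattice hd, fun L hL => ?_, fun v hv => ?_,
    fun γ hγ x hx => X.mulVec_mem_denomLattice hd hγ hx⟩
  · exact (hf L hL).2.trans (X.denomLattice_mono (hf L hL).1 hd
      (Dvd.dvd.mul_left (Finset.dvd_prod_of_mem f hL) d₀))
  · exact X.denomLattice_mono hd₀ hd (dvd_mul_right d₀ _) (hT v hv)

/-- **(I2) FOR A LOCALISER**: the support of `coefQ (loc N)` lies in `xm + (𝔭 𝔭̄)^N L′` for ONE `Γ`-stable lattice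
`L′ = d⁻¹ 𝒪³ ∋ xm` (all the support lattices of `ℓ.supp` inside it). -/
theorem exists_stable_lattice_supp (D : X.ThetaData)
    {p : IsDedekindDomain.HeightOneSpectrum (NumberField.RingOfIntegers X.E)}
    {L₀ : Submodule (NumberField.RingOfIntegers X.E) (Fin 3 → X.E)} {xm : X.Tuple} (ℓ : X.LocS D p L₀ xm) :
    ∃ d : 𝓞 X.E, d ≠ 0 ∧ X.IsLattice (X.denomLattice d) ∧ (∀ j, xm j ∈ X.denomLattice d) ∧
      (∀ γ ∈ X.Γ, ∀ x ∈ X.denomLattice d, γ *ᵥ x ∈ X.denomLattice d) ∧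
      ∀ N (w : X.LineTuple), X.coefQ D.cf (ℓ.loc N) (X.rep w) ≠ 0 → ∃ x : X.Tuple, X.lines x = w ∧
        ∀ j, x j - xm j ∈ (p.asIdeal * X.conjIdeal p.asIdeal) ^ N • X.denomLattice d := by
  classical
  obtain ⟨S, hS, hsupp⟩ := ℓ.supp
  obtain ⟨d, hd, hlat, hle, hxm, hst⟩ :=
    X.exists_stable_lattice S (fun L hL => (hS L hL).1) (Finset.univ.image xm)
  refine ⟨d, hd, hlat, fun j => hxm _ (Finset.mem_image.mpr ⟨j, Finset.mem_univ _, rfl⟩), hst, ?_⟩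
  intro N w hw
  obtain ⟨x, hx, L, hL, hxL⟩ := hsupp N w hw
  exact ⟨x, hx, fun j => Submodule.smul_mono le_rfl (hle L hL) (hxL j)⟩

end T4Data

end Summit.Ventures.HodgeRepro.Tier4.Line3

end
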